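import Mathlib.Topology.Compactification.OnePoint.Sphere
import Literature.AlgebraicTopology.CharacteristicClasses.ProjectiveHyperplaneCover
import Literature.AlgebraicTopology.CharacteristicClasses.ProjectiveLine
import Literature.AlgebraicTopology.SingularHomology.MayerVietorisIsoRight
import Literature.AlgebraicTopology.SingularHomology.ContractiblePunctured
import Literature.AlgebraicTopology.SingularHomology.ExcisionMayerVietorisProofs
import HarnessLib

/-!
# `H₁(ℂPⁿ) = 0` and `H₂(ℂP¹) ≅ H₂(ℂPⁿ)` by the inclusion of a line

Topic `Literature/AlgebraicTopology/CharacteristicClasses`. For a finite-dimensional complex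
normed space `V` of dimension `≥ 2` and a projective line `ι : ℂP¹ = OnePoint ℂ → ℙ(V)`
(`projectiveLine e₀ e₁ φ₀ φ₁`, through `[e₀]`, `[e₁]`), in the tree's singular homology with any
coefficients:

* `isZero_singularHomology_projectivization_one` — **`H₁(ℙ(V); M) = 0`**;
* `isIso_singularHomology_map_projectiveLine_two` — **`ι_* : H₂(ℂP¹; M) ≅ H₂(ℙ(V); M)`**.

This is the low-dimensional part of the cellular computation of `H_*(ℂPⁿ)` (A. Hatcher,
*Algebraic Topology* (2002), Ch. 0 p. 7 and Example 2.42 / the cell structure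
`ℂPⁿ = ℂPⁿ⁻¹ ∪ e²ⁿ`: the inclusion `ℂPⁿ⁻¹ ↪ ℂPⁿ` is an isomorphism on `H_q` for `q < 2n - 1`),
proved by induction on `dim V` with the Mayer–Vietoris sequence of the cover of `ℙ(V)`
(`V = W ⊕ ℂu`) by the affine chart `{ψ ≠ 0}` (contractible) and the complement `ℙ(V) ∖ {[u]}` of
its centre (which retracts onto `ℙ(W)`, `ProjectiveDeformation`), whose overlap is
`W ∖ 0 ≃ S^{2n-3}` (`ProjectiveHyperplaneCover`; `H₁ = H₂ = 0` for `n ≥ 3`, path connected): by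
`mayerVietoris.isIso_map_right_of_isZero` the inclusion `ℙ(V) ∖ {[u]} ↪ ℙ(V)`, hence
`ℙ(W) ↪ ℙ(V)`, is an isomorphism on `H₁` and `H₂`. The induction starts at `dim V = 2`, where the
projective line is a HOMEOMORPHISM `OnePoint ℂ ≅ ℙ(V)` (`projectiveLineHomeomorph`) and
`H₁(OnePoint ℂ) = H₁(S²) = 0` (Mathlib's `onePointEquivSphereOfFinrankEq` and the tree's
`isZero_singularHomology_sphere`).

Everything is proved; no named facts. These two facts are the homological input of the
classification step of the uniqueness of Chern classes (`H²(ℙ(H); ℤ) → H²(ℂP¹; ℤ)` injective).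

## References

* A. Hatcher, *Algebraic Topology*, CUP 2002, Ch. 0 p. 7 (cells of `ℂPⁿ`), §2.2 p. 149
  (Mayer–Vietoris), Example 2.42, Cor. 2.11, Cor. 2.14 (`H_*(Sⁿ)`). [Hatcher2002]
-/

noncomputable section

open Function Set Filter Topology Module CategoryTheory
open Literature.AlgebraicTopology.SingularHomology
open scoped LinearAlgebra.Projectivization OnePoint

universe v

namespace Literature.AlgebraicTopology.CharacteristicClasses

variable (R : Type v) [CommRing R] (M : Type v) [AddCommGroup M] [Module R M]

/-! ### The punctured chart: a homology sphere of dimension `2n - 3 ≥ 3` -/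

section Pieces

variable {V : Type} [NormedAddCommGroup V] [NormedSpace ℂ V] [FiniteDimensional ℂ V]
  {ψ : StrongDual ℂ V} {u : V} (hu : ψ u = 1) (hV : 3 ≤ finrank ℂ V)
include hu hV

/-- The overlap `U_ψ ∩ (ℙ V ∖ {[u]})` has `H₁ = H₂ = 0`: it is `W ∖ 0 ≃ S^{2n-3}` with
`2n - 3 ≥ 3` (Hatcher 2002, Cor. 2.14). [cite: Hatcher2002, Cor. 2.14] -/
theorem isZero_singularHomology_puncturedChart {q : ℕ} (hq : q = 1 ∨ q = 2) :
    Limits.IsZero (singularHomology R M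
      ↥(chartDomain (ψ : Module.Dual ℂ V) ∩ projChart (hyperplaneProj ψ u)) q) := by
  -- `W ∖ 0 ≅ ℝᵐ⁺¹ ∖ 0`, `m = 2n - 3`
  set m : ℕ := 2 * (finrank ℂ V - 1) - 1 with hm
  have hm1 : m + 1 = 2 * (finrank ℂ V - 1) := by omega
  let e := (puncturedChartHomeomorph hu).trans (puncturedKerHomeomorphEuclidean hu (m + 1) hm1)
  have hS : Limits.IsZero (singularHomology R M ↥(unitSphere (m + 1)) q) :=
    isZero_singularHomology_sphere_holds R M (n := m) (k := q) (by omega) (by omega)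
  haveI := isIso_singularHomology_map_sphereToComplZero R M m q
  exact (hS.of_iso (asIso (singularHomology.map R M (sphereToComplZero m) q)).symm).of_iso
    (singularHomology.mapIso R M e q)

/-- The overlap `U_ψ ∩ (ℙ V ∖ {[u]}) ≅ W ∖ 0` is path connected (`dim_ℝ W ≥ 4 > 1`). [folklore] -/
theorem pathConnectedSpace_puncturedChart :
    PathConnectedSpace ↥(chartDomain (ψ : Module.Dual ℂ V) ∩ projChart (hyperplaneProj ψ u)) := by
  have hr : 1 < Module.rank ℝ ↥(LinearMap.ker (ψ : V →ₗ[ℂ] ℂ)) := by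
    rw [← Module.finrank_eq_rank, finrank_real_ker hu]
    exact_mod_cast (show 1 < 2 * (finrank ℂ V - 1) by omega)
  have hpc := isPathConnected_compl_singleton_of_one_lt_rank hr
    (0 : ↥(LinearMap.ker (ψ : V →ₗ[ℂ] ℂ)))
  haveI : PathConnectedSpace ↥(({0}ᶜ : Set ↥(LinearMap.ker (ψ : V →ₗ[ℂ] ℂ)))) :=
    isPathConnected_iff_pathConnectedSpace.1 hpc
  rw [pathConnectedSpace_iff_univ,
    ← image_univ_of_surjective (puncturedChartHomeomorph hu).symm.surjective]
  exact isPathConnected_univ.image (puncturedChartHomeomorph hu).symm.continuous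

/-- **The complement of the centre of the cell carries `H₁` and `H₂`**: the inclusion
`ℙ V ∖ {[u]} ↪ ℙ V` is an isomorphism on `H₁` and on `H₂` (`dim V ≥ 3`), by Mayer–Vietoris for the
cover by the contractible affine chart `U_ψ` and `ℙ V ∖ {[u]}`, whose overlap is a homology
`(2n-3)`-sphere, path connected (Hatcher 2002, §2.2 p. 149 and Ch. 0 p. 7).
[cite: Hatcher2002, §2.2 p. 149] -/
theorem isIso_singularHomology_map_subsetIncl_projChart {q : ℕ} (hq : q = 1 ∨ q = 2) :
    IsIso (singularHomology.map R M (subsetIncl (projChart (hyperplaneProj ψ u))) q) := by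
  haveI hcU : ContractibleSpace ↥(chartDomain (ψ : Module.Dual ℂ V)) := contractibleSpace_chartDomain hu
  rcases hq with rfl | rfl
  · refine mayerVietoris.isIso_map_right_of_isZero R M _ _
      (interior_chartDomain_union_interior_projChart hu) 0
      (isZero_singularHomology_puncturedChart R M hu hV (Or.inl rfl))
      (isZero_singularHomology_of_contractibleSpace R M one_ne_zero) ?_
    haveI := pathConnectedSpace_puncturedChart hu hV
    haveI := singularHomology.isIso_map_zero_of_pathConnectedSpace R M
      (subsetInclusion (inter_subset_left :
        chartDomain (ψ : Module.Dual ℂ V) ∩ projChart (hyperplaneProj ψ u) ⊆ _))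
    infer_instance
  · exact mayerVietoris.isIso_map_right_of_isZero R M _ _
      (interior_chartDomain_union_interior_projChart hu) 1
      (isZero_singularHomology_puncturedChart R M hu hV (Or.inr rfl))
      (isZero_singularHomology_of_contractibleSpace R M two_ne_zero)
      ⟨fun _ _ _ ↦ (isZero_singularHomology_puncturedChart R M hu hV (Or.inl rfl)).eq_of_tgt _ _⟩

/-- The inclusion `ℙ(W) → ℙ(V)`, `W = range P`, as a continuous map. [folklore] -/
abbrev rangeProjectivizationMapC (P : V →L[ℂ] V) : C(ℙ ℂ ↥(LinearMap.range (P : V →ₗ[ℂ] V)), ℙ ℂ V) :=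
  ⟨rangeProjectivizationMap P, continuous_rangeProjectivizationMap P⟩

omit hu hV in
/-- The inclusion `ℙ(range P) → ℙ V` factors as `ℙ(range P) ≅ rangeLocus P ↪ projChart P ↪ ℙ V`.
[folklore] -/
theorem rangeProjectivizationMapC_eq (P : V →L[ℂ] V) (hP : ∀ v, P (P v) = P v) :
    rangeProjectivizationMapC P = (subsetIncl (projChart P)).comp
      ((rangeLocusInclusion P).comp (rangeLocusHomeomorph P hP : C(_, _))) :=
  ContinuousMap.ext fun _ ↦ rfl

/-- **`ℙ(W) ↪ ℙ(V)` is an isomorphism on `H₁` and `H₂`** for the hyperplane `W = ker ψ = range P`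
(`dim V ≥ 3`): composite of the homeomorphism `ℙ(W) ≅ rangeLocus P`, the deformation retract
`rangeLocus P ↪ projChart P` and `projChart P ↪ ℙ V` (Hatcher 2002, Ch. 0 p. 7: the inclusion
`ℂPⁿ⁻¹ ↪ ℂPⁿ` is an isomorphism below the top cell). [cite: Hatcher2002, Ch. 0 p. 7] -/
theorem isIso_singularHomology_map_rangeProjectivizationMapC {q : ℕ} (hq : q = 1 ∨ q = 2) :
    IsIso (singularHomology.map R M (rangeProjectivizationMapC (hyperplaneProj ψ u)) q) := by
  have hP := hyperplaneProj_idem hu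
  haveI := isIso_singularHomology_map_subsetIncl_projChart R M hu hV hq
  haveI := isIso_singularHomology_map_rangeLocusInclusion (hyperplaneProj ψ u) R M hP q
  rw [rangeProjectivizationMapC_eq _ hP, singularHomology.map_comp, singularHomology.map_comp,
    ← singularHomology.mapIso_hom]
  infer_instance

end Pieces

/-! ### Dimension two: the projective line is a homeomorphism -/

section Two

variable {V : Type} [NormedAddCommGroup V] [NormedSpace ℂ V] [FiniteDimensional ℂ V]
  (e₀ e₁ : V) (φ₀ φ₁ : StrongDual ℂ V)
  (h₀₀ : φ₀ e₀ = 1) (h₀₁ : φ₀ e₁ = 0) (h₁₀ : φ₁ e₀ = 0) (h₁₁ : φ₁ e₁ = 1)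

include h₀₀ h₀₁ h₁₀ h₁₁ in
/-- In dimension `2`, `{e₀, e₁}` (with dual functionals) is a basis: `v = φ₀(v) e₀ + φ₁(v) e₁`.
[folklore] -/
theorem eq_smul_add_smul (h2 : finrank ℂ V = 2) (v : V) : v = φ₀ v • e₀ + φ₁ v • e₁ := by
  have hli : LinearIndependent ℂ ![e₀, e₁] := by
    refine LinearIndependent.pair_iff.2 fun s t hst ↦ ⟨?_, ?_⟩
    · simpa [h₀₀, h₀₁] using congrArg φ₀ hst
    · simpa [h₁₀, h₁₁] using congrArg φ₁ hst
  have htop : Submodule.span ℂ (Set.range ![e₀, e₁]) = ⊤ :=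
    Submodule.eq_top_of_finrank_eq (by rw [finrank_span_eq_card hli, h2]; rfl)
  obtain ⟨c, hc⟩ := (Submodule.mem_span_range_iff_exists_fun ℂ).1
    (show v ∈ Submodule.span ℂ (Set.range ![e₀, e₁]) by rw [htop]; trivial)
  simp only [Fin.sum_univ_two, Matrix.cons_val_zero, Matrix.cons_val_one] at hc
  have h0 : φ₀ v = c 0 := by rw [← hc]; simp [h₀₀, h₀₁]
  have h1 : φ₁ v = c 1 := by rw [← hc]; simp [h₁₀, h₁₁]
  rw [h0, h1, hc]

include h₀₀ h₀₁ h₁₀ h₁₁ in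
/-- In dimension `2` the projective line through `[e₀]`, `[e₁]` is onto. [folklore] -/
theorem surjective_projectiveLine (h2 : finrank ℂ V = 2) :
    Surjective (projectiveLine e₀ e₁ φ₀ φ₁ h₀₀ h₀₁ h₁₀ h₁₁) := by
  intro p
  induction p with
  | h v hv =>
    have hvd := eq_smul_add_smul e₀ e₁ φ₀ φ₁ h₀₀ h₀₁ h₁₀ h₁₁ h2 v
    set a := φ₀ v with ha_def
    set b := φ₁ v with hb_def
    by_cases hb : b = 0
    · have ha : a ≠ 0 := fun ha ↦ hv (by rw [hvd, ha, hb, zero_smul, zero_smul, add_zero])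
      refine ⟨∞, ?_⟩
      rw [projectiveLine_infty, Projectivization.mk_eq_mk_iff']
      exact ⟨a⁻¹, by rw [hvd, hb, zero_smul, add_zero, smul_smul, inv_mul_cancel₀ ha, one_smul]⟩
    · refine ⟨((a / b : ℂ) : OnePoint ℂ), ?_⟩
      rw [projectiveLine_coe, Projectivization.mk_eq_mk_iff']
      refine ⟨b⁻¹, ?_⟩
      rw [hvd, smul_add, smul_smul, smul_smul, inv_mul_cancel₀ hb, one_smul, lineVec, div_eq_inv_mul]

include h₀₀ h₀₁ h₁₀ h₁₁ in
omit [FiniteDimensional ℂ V] in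
/-- The projective line through `[e₀]`, `[e₁]` is injective (in any dimension). [folklore] -/
theorem injective_projectiveLine : Injective (projectiveLine e₀ e₁ φ₀ φ₁ h₀₀ h₀₁ h₁₀ h₁₁) := by
  intro x y hxy
  induction x using OnePoint.rec with
  | infty =>
    induction y using OnePoint.rec with
    | infty => rfl
    | coe t =>
      exfalso
      rw [projectiveLine_infty, projectiveLine_coe, Projectivization.mk_eq_mk_iff'] at hxy
      obtain ⟨a, ha⟩ := hxy
      have h1 := congrArg φ₁ ha
      rw [map_smul, apply_lineVec_one e₀ e₁ φ₁ h₁₀ h₁₁, h₁₀, smul_eq_mul, mul_one] at h1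
      rw [h1, zero_smul] at ha
      exact ne_zero_of_dual e₀ φ₀ h₀₀ ha.symm
  | coe s =>
    induction y using OnePoint.rec with
    | infty =>
      exfalso
      rw [projectiveLine_infty, projectiveLine_coe, Projectivization.mk_eq_mk_iff'] at hxy
      obtain ⟨a, ha⟩ := hxy
      have h1 := congrArg φ₁ ha
      rw [map_smul, h₁₀, smul_eq_mul, mul_zero, apply_lineVec_one e₀ e₁ φ₁ h₁₀ h₁₁] at h1
      exact zero_ne_one h1
    | coe t =>
      rw [projectiveLine_coe, projectiveLine_coe, Projectivization.mk_eq_mk_iff'] at hxy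
      obtain ⟨a, ha⟩ := hxy
      have h1 := congrArg φ₁ ha
      rw [map_smul, apply_lineVec_one e₀ e₁ φ₁ h₁₀ h₁₁, apply_lineVec_one e₀ e₁ φ₁ h₁₀ h₁₁,
        smul_eq_mul, mul_one] at h1
      rw [h1, one_smul] at ha
      have h0 := congrArg φ₀ ha
      rw [apply_lineVec_zero e₀ e₁ φ₀ h₀₀ h₀₁, apply_lineVec_zero e₀ e₁ φ₀ h₀₀ h₀₁] at h0
      rw [h0]

/-- **In dimension `2` the projective line is a homeomorphism `ℂP¹ = OnePoint ℂ ≅ ℙ(V)`** (a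
continuous bijection from a compact space onto a Hausdorff space). [folklore] -/
def projectiveLineHomeomorph (h2 : finrank ℂ V = 2) : OnePoint ℂ ≃ₜ ℙ ℂ V :=
  Continuous.homeoOfEquivCompactToT2
    (f := Equiv.ofBijective _ ⟨injective_projectiveLine e₀ e₁ φ₀ φ₁ h₀₀ h₀₁ h₁₀ h₁₁,
      surjective_projectiveLine e₀ e₁ φ₀ φ₁ h₀₀ h₀₁ h₁₀ h₁₁ h2⟩)
    (projectiveLine e₀ e₁ φ₀ φ₁ h₀₀ h₀₁ h₁₀ h₁₁).continuous

/-- The homeomorphism is the projective line on points. [folklore] -/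
theorem projectiveLineHomeomorph_toContinuousMap (h2 : finrank ℂ V = 2) :
    (projectiveLineHomeomorph e₀ e₁ φ₀ φ₁ h₀₀ h₀₁ h₁₀ h₁₁ h2 : C(OnePoint ℂ, ℙ ℂ V)) =
      projectiveLine e₀ e₁ φ₀ φ₁ h₀₀ h₀₁ h₁₀ h₁₁ :=
  rfl

end Two

/-- **`H₁(ℂP¹; M) = 0`** in the model `ℂP¹ = OnePoint ℂ ≅ S²` (Mathlib's
`onePointEquivSphereOfFinrankEq`; Hatcher 2002, Cor. 2.14). [cite: Hatcher2002, Cor. 2.14] -/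
theorem isZero_singularHomology_onePoint_complex_one :
    Limits.IsZero (singularHomology R M (OnePoint ℂ) 1) := by
  let e : OnePoint ℂ ≃ₜ ↥(Metric.sphere (0 : EuclideanSpace ℝ (Fin 3)) 1) :=
    onePointEquivSphereOfFinrankEq (by rw [Complex.finrank_real_complex]; rfl)
  exact (isZero_singularHomology_sphere_holds R M (n := 2) (k := 1) one_ne_zero (by norm_num)).of_iso
    (singularHomology.mapIso R M e 1)

/-! ### The induction on the dimension -/

/-- The inductive statement: `H₁(ℙ V) = 0` and `ι_* : H₂(ℂP¹) ≅ H₂(ℙ V)` for every `V` of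
dimension `n + 2` with a projective line `ι`. [cite: Hatcher2002, Ch. 0 p. 7 and §2.2 p. 149] -/
theorem lowHomology_aux (n : ℕ) :
    ∀ (V : Type) [NormedAddCommGroup V] [NormedSpace ℂ V] [FiniteDimensional ℂ V],
      finrank ℂ V = n + 2 →
      ∀ (e₀ e₁ : V) (φ₀ φ₁ : StrongDual ℂ V) (h₀₀ : φ₀ e₀ = 1) (h₀₁ : φ₀ e₁ = 0)
        (h₁₀ : φ₁ e₀ = 0) (h₁₁ : φ₁ e₁ = 1),
        Limits.IsZero (singularHomology R M (ℙ ℂ V) 1) ∧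
          IsIso (singularHomology.map R M (projectiveLine e₀ e₁ φ₀ φ₁ h₀₀ h₀₁ h₁₀ h₁₁) 2) := by
  induction n with
  | zero =>
    intro V _ _ _ h2 e₀ e₁ φ₀ φ₁ h₀₀ h₀₁ h₁₀ h₁₁
    let e := projectiveLineHomeomorph e₀ e₁ φ₀ φ₁ h₀₀ h₀₁ h₁₀ h₁₁ h2
    refine ⟨(isZero_singularHomology_onePoint_complex_one R M).of_iso
      (singularHomology.mapIso R M e 1).symm, ?_⟩
    rw [← projectiveLineHomeomorph_toContinuousMap e₀ e₁ φ₀ φ₁ h₀₀ h₀₁ h₁₀ h₁₁ h2,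
      ← singularHomology.mapIso_hom]
    infer_instance
  | succ k ih =>
    intro V _ _ _ hdim e₀ e₁ φ₀ φ₁ h₀₀ h₀₁ h₁₀ h₁₁
    -- a hyperplane `W = ker ψ ∋ e₀, e₁` with complementary `u`
    obtain ⟨ψ, u, hψ₀, hψ₁, hu⟩ := exists_hyperplane (by omega) e₀ e₁
    have hV : 3 ≤ finrank ℂ V := by omega
    have hWdim : finrank ℂ ↥(LinearMap.range ((hyperplaneProj ψ u : V →L[ℂ] V) : V →ₗ[ℂ] V)) =
        k + 2 := by
      have := finrank_range_hyperplaneProj hu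
      omega
    -- the line lies in `W = range P`
    have hmem : ∀ {v : V}, ψ v = 0 →
        v ∈ LinearMap.range ((hyperplaneProj ψ u : V →L[ℂ] V) : V →ₗ[ℂ] V) := fun {v} hv ↦
      ⟨v, (hyperplaneProj_eq_self_iff (ne_zero_of_apply_eq_one hu) v).2 hv⟩
    obtain ⟨hW1, hW2⟩ := ih ↥(LinearMap.range ((hyperplaneProj ψ u : V →L[ℂ] V) : V →ₗ[ℂ] V))
      hWdim ⟨e₀, hmem hψ₀⟩ ⟨e₁, hmem hψ₁⟩ (φ₀.comp (Submodule.subtypeL _))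
      (φ₁.comp (Submodule.subtypeL _)) h₀₀ h₀₁ h₁₀ h₁₁
    haveI h1 := isIso_singularHomology_map_rangeProjectivizationMapC R M hu hV (Or.inl rfl)
    haveI h2 := isIso_singularHomology_map_rangeProjectivizationMapC R M hu hV (Or.inr rfl)
    refine ⟨hW1.of_iso
      (asIso (singularHomology.map R M (rangeProjectivizationMapC (hyperplaneProj ψ u)) 1)).symm, ?_⟩
    have hfac : projectiveLine e₀ e₁ φ₀ φ₁ h₀₀ h₀₁ h₁₀ h₁₁ =
        (rangeProjectivizationMapC (hyperplaneProj ψ u)).comp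
          (projectiveLine (⟨e₀, hmem hψ₀⟩ : ↥(LinearMap.range _)) ⟨e₁, hmem hψ₁⟩
            (φ₀.comp (Submodule.subtypeL _)) (φ₁.comp (Submodule.subtypeL _)) h₀₀ h₀₁ h₁₀ h₁₁) := by
      ext x : 1
      induction x using OnePoint.rec with
      | infty => rfl
      | coe t => rfl
    rw [hfac, singularHomology.map_comp]
    infer_instance

section Main

variable {V : Type} [NormedAddCommGroup V] [NormedSpace ℂ V] [FiniteDimensional ℂ V]
  (e₀ e₁ : V) (φ₀ φ₁ : StrongDual ℂ V)
  (h₀₀ : φ₀ e₀ = 1) (h₀₁ : φ₀ e₁ = 0) (h₁₀ : φ₁ e₀ = 0) (h₁₁ : φ₁ e₁ = 1)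

include h₀₀ h₀₁ h₁₀ h₁₁ in
/-- A space with two vectors having dual functionals has dimension `≥ 2`. [folklore] -/
theorem two_le_finrank : 2 ≤ finrank ℂ V := by
  have hli : LinearIndependent ℂ ![e₀, e₁] := by
    refine LinearIndependent.pair_iff.2 fun s t hst ↦ ⟨?_, ?_⟩
    · simpa [h₀₀, h₀₁] using congrArg φ₀ hst
    · simpa [h₁₀, h₁₁] using congrArg φ₁ hst
  simpa using hli.fintype_card_le_finrank

include e₀ e₁ φ₀ φ₁ h₀₀ h₀₁ h₁₀ h₁₁ in
/-- **`H₁(ℙ(V); M) = 0`** for a finite-dimensional complex `V` containing a projective line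
(`dim V ≥ 2`, witnessed by the line data; Hatcher 2002, Ch. 0 p. 7 / Example 2.42:
`H₁(ℂPⁿ) = 0`). [cite: Hatcher2002, Ch. 0 p. 7] -/
theorem isZero_singularHomology_projectivization_one :
    Limits.IsZero (singularHomology R M (ℙ ℂ V) 1) :=
  (lowHomology_aux R M (finrank ℂ V - 2) V
    (by have := two_le_finrank e₀ e₁ φ₀ φ₁ h₀₀ h₀₁ h₁₀ h₁₁; omega)
    e₀ e₁ φ₀ φ₁ h₀₀ h₀₁ h₁₀ h₁₁).1

/-- **The projective line induces an isomorphism `H₂(ℂP¹; M) ≅ H₂(ℙ(V); M)`** for a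
finite-dimensional complex `V` (Hatcher 2002, Ch. 0 p. 7 / Example 2.42: `ℂP¹ ↪ ℂPⁿ` is an
isomorphism on `H₂`). [cite: Hatcher2002, Ch. 0 p. 7] -/
theorem isIso_singularHomology_map_projectiveLine_two :
    IsIso (singularHomology.map R M (projectiveLine e₀ e₁ φ₀ φ₁ h₀₀ h₀₁ h₁₀ h₁₁) 2) :=
  (lowHomology_aux R M (finrank ℂ V - 2) V
    (by have := two_le_finrank e₀ e₁ φ₀ φ₁ h₀₀ h₀₁ h₁₀ h₁₁; omega)
    e₀ e₁ φ₀ φ₁ h₀₀ h₀₁ h₁₀ h₁₁).2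

end Main

end Literature.AlgebraicTopology.CharacteristicClasses
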